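import Literature.Barriers.Schanuel.NesterenkoModularScopeTransferToolkit
import Literature.Barriers.Schanuel.NesterenkoModularScopeCh10Prelim
import Literature.Barriers.Schanuel.NesterenkoModularScopeMultiplicityProofs
import Mathlib.RingTheory.Ideal.MinimalPrime.Noetherian
import HarnessLib

/-!
# Barrier (Schanuel) `NesterenkoModularScope`: deep primes contain no `T`-stable prime (LNM 1752 Ch. 10 Lemma 3.4, projectivised) — proofs and definitions

Proofs-and-definitions sibling of `NesterenkoModularScopeTransfer*.lean`; nothing is asserted as a
fact. With `z` projectivised as the coordinate `x₁` over `ℚ` (see `NesterenkoModularScopeTransfer`),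
the operator `T` of Ch. 10 §3 (the homogenisation of `D = z ∂/∂z + (1/12)(x₁² − x₂)∂₁ + …`, with
`T x₀ = 0`) acts on `ℚ[x₀, …, x₄]`, and Lemma 3.4 of Ch. 10 becomes: a homogeneous prime `𝔭` all of
whose members vanish along `ω̂ = (1, z, P, Q, R)` to order `> 2` (which holds as soon as
`ord 𝔭 > 2 r deg 𝔭`, `ordI_le_smul_ordAlongQ_of_mem`) contains `x₀ ∉ 𝔭` and no non-zero
`T`-stable prime `𝔮 ⊆ 𝔭`. The `D`-property of `(P, Q, R)` with `c = 2` is PROVED in the tree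
(`hasRamanujanDProperty_two`, Ch. 10 Prop. 5.1); it concerns primes of `ℂ[z, x₁, x₂, x₃]`, so the
proof passes through the minimal primes of the complexified dehomogenisation of `𝔮` (which are
`D`-stable: Seidenberg's lemma, proved here) and the zeros `β̄(z₀) ∈ V(𝔭)` close to `ω̄(z₀)`
delivered by Prop. 4.13 of Ch. 3.

## References

* [NesterenkoPhilippon2001] Yu. V. Nesterenko, P. Philippon (eds.), *Introduction to Algebraic
  Independence Theory*, LNM 1752, Springer 2001, Ch. 10 §3, (55), the operator `T`, Lemma 3.4
  (pp. 154–156); Ch. 3 Prop. 4.13, Cor. 4.9 (pp. 40–41).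
* [Kaplansky1957] I. Kaplansky, *An Introduction to Differential Algebra*, Hermann 1957, Lemma 1.8
  (radicals of differential ideals over `ℚ`-algebras).
* [Seidenberg1967] A. Seidenberg, *Differential ideals in rings of finitely generated type*,
  Amer. J. Math. 89 (1967) 22–42, Thm. 1 (minimal primes of a differential ideal).
-/

noncomputable section

open Complex MvPolynomial Filter Topology
open Literature.NumberTheory.Transcendental Literature.NumberTheory.Transcendental.Nesterenko

attribute [local instance] MvPolynomial.gradedAlgebra

namespace Literature.Barriers.Schanuel

/-! ### Differential ideals: radicals and minimal primes (Kaplansky, Seidenberg) -/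

namespace DiffIdeal

variable {A : Type*} [CommRing A] [Algebra ℚ A] (D : Derivation ℚ A A)

/-- **Kaplansky's lemma, the inductive step**: if `I` is `D`-stable and `aⁿ ∈ I` then
`a^{n−k} (Da)^{2k} ∈ I` for all `k ≤ n`. [cite: Kaplansky1957, Lemma 1.8] -/
theorem pow_mul_pow_apply_mem {I : Ideal A} (hI : ∀ x ∈ I, D x ∈ I) {a : A} {n : ℕ} (han : a ^ n ∈ I) :
    ∀ k, k ≤ n → a ^ (n - k) * D a ^ (2 * k) ∈ I := by
  intro k
  induction k with
  | zero => intro _; simpa using han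
  | succ k ih =>
    intro hk
    have hk' : k ≤ n := by omega
    set u := a ^ (n - k) * D a ^ (2 * k) with hu
    have huI : u ∈ I := ih hk'
    have hDu : D u ∈ I := hI u huI
    -- `Du · Da = (n-k) a^{n-k-1} (Da)^{2k+2} + 2k u D²a`
    have hnk : n - k = (n - (k + 1)) + 1 := by omega
    have key : D u * D a = ((n - k : ℕ) : A) * (a ^ (n - (k + 1)) * D a ^ (2 * (k + 1))) +
        ((2 * k : ℕ) : A) * u * D (D a) := by
      rw [hu, Derivation.leibniz, Derivation.leibniz_pow, Derivation.leibniz_pow, hnk,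
        Nat.add_sub_cancel]
      simp only [smul_eq_mul, nsmul_eq_mul]
      rcases Nat.eq_zero_or_pos k with hk0 | hkpos
      · subst hk0; simp; ring
      · have h2k : 2 * k = (2 * k - 1) + 1 := by omega
        conv_lhs => rw [h2k, Nat.add_sub_cancel]
        conv_rhs => rw [h2k]
        rw [show 2 * (k + 1) = (2 * k - 1) + 1 + 1 + 1 by omega]
        push_cast
        ring
    have h1 : D u * D a ∈ I := I.mul_mem_right _ hDu
    have h2 : ((2 * k : ℕ) : A) * u * D (D a) ∈ I :=
      I.mul_mem_right _ (I.mul_mem_left _ huI)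
    have h3 : ((n - k : ℕ) : A) * (a ^ (n - (k + 1)) * D a ^ (2 * (k + 1))) ∈ I := by
      have := I.sub_mem h1 h2
      rwa [key, add_sub_cancel_right] at this
    -- divide by the unit `n - k`
    have hunit : IsUnit (((n - k : ℕ) : A)) := by
      have : ((n - k : ℕ) : A) = algebraMap ℚ A ((n - k : ℕ) : ℚ) := by simp
      rw [this]
      exact (IsUnit.mk0 _ (by exact_mod_cast (show n - k ≠ 0 by omega))).map _
    obtain ⟨w, hw⟩ := hunit
    have := I.mul_mem_left (↑w⁻¹ : A) h3
    rwa [← mul_assoc, ← hw, Units.inv_mul, one_mul] at this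

/-- **Kaplansky's lemma**: over a `ℚ`-algebra the radical of a `D`-stable ideal is `D`-stable.
[cite: Kaplansky1957, Lemma 1.8] -/
theorem radical_stable {I : Ideal A} (hI : ∀ x ∈ I, D x ∈ I) : ∀ x ∈ I.radical, D x ∈ I.radical := by
  intro a ha
  obtain ⟨n, han⟩ := ha
  refine ⟨2 * n, ?_⟩
  have := pow_mul_pow_apply_mem D hI han n le_rfl
  simpa using this

/-- **Seidenberg's lemma**: in a Noetherian `ℚ`-algebra the minimal primes of a `D`-stable ideal
are `D`-stable. (Proof: pass to the radical, `J = P₁ ∩ … ∩ P_k`; for `x ∈ P₁` pick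
`y ∈ (P₂ ∩ … ∩ P_k) ∖ P₁`; then `xy ∈ J`, so `D(xy) = y Dx + x Dy ∈ J ⊆ P₁` forces `Dx ∈ P₁`.)
[cite: Seidenberg1967, Thm. 1] -/
theorem minimalPrimes_stable [IsNoetherianRing A] {I : Ideal A} (hI : ∀ x ∈ I, D x ∈ I)
    {P : Ideal A} (hP : P ∈ I.minimalPrimes) : ∀ x ∈ P, D x ∈ P := by
  classical
  have hPprime : P.IsPrime := hP.1.1
  have hIP : I ≤ P := hP.1.2
  -- the finite set of minimal primes and the radical
  obtain ⟨S, hS⟩ : ∃ S : Finset (Ideal A), (S : Set (Ideal A)) = I.minimalPrimes :=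
    ⟨(Ideal.finite_minimalPrimes_of_isNoetherianRing A I).toFinset, by simp⟩
  have hrad : I.radical = S.inf id := by
    rw [← Ideal.sInf_minimalPrimes, ← hS, Finset.inf_id_eq_sInf]
  have hradD : ∀ x ∈ I.radical, D x ∈ I.radical := radical_stable D hI
  have hPS : P ∈ S := by rw [← Finset.mem_coe, hS]; exact hP
  -- an element of the other minimal primes outside `P`
  have hnot : ¬ ((S.erase P).inf id ≤ P) := by
    intro hle
    obtain ⟨Q, hQ, hQP⟩ := (Ideal.IsPrime.inf_le' hPprime).mp hle
    obtain ⟨hQne, hQS⟩ := Finset.mem_erase.mp hQ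
    have hQmin : Q ∈ I.minimalPrimes := by rw [← hS]; exact Finset.mem_coe.mpr hQS
    have hPQ : P ≤ Q := hP.2 ⟨hQmin.1.1, hQmin.1.2⟩ hQP
    exact hQne (le_antisymm hQP hPQ)
  obtain ⟨y, hyT, hyP⟩ := SetLike.not_le_iff_exists.mp hnot
  intro x hx
  -- `x y ∈ √I`
  have hxy : x * y ∈ I.radical := by
    rw [hrad]
    refine Submodule.mem_finsetInf.mpr fun Q hQ => ?_
    by_cases hQP : Q = P
    · subst hQP; exact Ideal.mul_mem_right _ _ hx
    · have : y ∈ Q := Submodule.mem_finsetInf.mp hyT Q (Finset.mem_erase.mpr ⟨hQP, hQ⟩)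
      exact Ideal.mul_mem_left _ _ this
  have hD : D (x * y) ∈ P := (hPprime.radical_le_iff.mpr hIP) (hradD _ hxy)
  rw [Derivation.leibniz, smul_eq_mul, smul_eq_mul] at hD
  have h1 : x * D y ∈ P := P.mul_mem_right _ hx
  have h2 : y * D x ∈ P := by
    have := P.sub_mem hD h1
    rwa [add_sub_cancel_left] at this
  exact (hPprime.mem_or_mem h2).resolve_left hyP

/-- The extension of a `D₁`-stable ideal along a ring map intertwining `D₁` and `D₂` is
`D₂`-stable. [folklore] -/
theorem map_stable {B : Type*} [CommRing B] [Algebra ℚ B] (D₂ : Derivation ℚ B B) (φ : A →+* B)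
    (hφ : ∀ x, φ (D x) = D₂ (φ x)) {I : Ideal A} (hI : ∀ x ∈ I, D x ∈ I) :
    ∀ y ∈ I.map φ, D₂ y ∈ I.map φ := by
  intro y hy
  refine Submodule.span_induction (p := fun y _ => D₂ y ∈ I.map φ) ?_ ?_ ?_ ?_ hy
  · rintro _ ⟨x, hx, rfl⟩
    rw [← hφ]
    exact Ideal.mem_map_of_mem _ (hI x hx)
  · simp
  · intro a b _ _ ha hb
    rw [map_add]
    exact Ideal.add_mem _ ha hb
  · intro c a hamem ha
    rw [smul_eq_mul, Derivation.leibniz, smul_eq_mul, smul_eq_mul]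
    exact Ideal.add_mem _ (Ideal.mul_mem_left _ _ ha) (Ideal.mul_mem_right _ _ hamem)

end DiffIdeal

/-! ### The operator `T` of Ch. 10 §3 for the Ramanujan system, with `z` projectivised -/

namespace Transfer

section Operator

variable (K : Type*) [Field K]

/-- The values `T xᵢ`: `T x₀ = 0`, `T x₁ = x₀x₁`, `T x₂ = (1/12)(x₂² − x₀x₃)`,
`T x₃ = (1/3)(x₂x₃ − x₀x₄)`, `T x₄ = (1/2)(x₂x₄ − x₃²)` — the forms `Bⱼ = x₀^d Aⱼ(x/x₀)`, `d = 2`, of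
(55) for the system (45) written with `D = z d/dz` (`x₁ = z`), including `B` for `z' = z` itself.
[cite: NesterenkoPhilippon2001, Ch. 10 §3 (55) and the operator `T` (pp. 154–155); §5 (p. 162)] -/
def homTValues : Fin 5 → MvPolynomial (Fin 5) K :=
  ![0, X 0 * X 1, C (1 / 12 : K) * (X 2 ^ 2 - X 0 * X 3), C (1 / 3 : K) * (X 2 * X 3 - X 0 * X 4),
    C (1 / 2 : K) * (X 2 * X 4 - X 3 ^ 2)]

/-- **The operator `T = ∑ⱼ Bⱼ ∂/∂xⱼ`** on `K[x₀, …, x₄]` (`T x₀ = 0`): the homogenisation of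
Nesterenko's `D` for the Ramanujan system with the variable `z` projectivised as `x₁`.
[cite: NesterenkoPhilippon2001, Ch. 10 §3, the operator `T` (p. 155)] -/
def homT : Derivation K (MvPolynomial (Fin 5) K) (MvPolynomial (Fin 5) K) :=
  MvPolynomial.mkDerivation K (homTValues K)

/-- `T` on the variables. [cite: NesterenkoPhilippon2001, Ch. 10 §3 (p. 155)] -/
theorem homT_X (i : Fin 5) : homT K (X i) = homTValues K i := by
  simp [homT, MvPolynomial.mkDerivation_X]

/-- "`T x₀ = 0`". [cite: NesterenkoPhilippon2001, Ch. 10 §3 (p. 155)] -/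
theorem homT_X_zero : homT K (X 0) = 0 := by rw [homT_X]; rfl

/-- The values `T xᵢ` are forms of degree `2`. [folklore] -/
theorem isHomogeneous_homTValues (i : Fin 5) : (homTValues K i).IsHomogeneous 2 := by
  have hX : ∀ j : Fin 5, (X j : MvPolynomial (Fin 5) K).IsHomogeneous 1 := fun j => isHomogeneous_X K j
  have hC : ∀ c : K, (C c : MvPolynomial (Fin 5) K).IsHomogeneous 0 := fun c => isHomogeneous_C _ c
  have h2 : ∀ j k : Fin 5, (X j * X k : MvPolynomial (Fin 5) K).IsHomogeneous 2 := fun j k =>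
    (hX j).mul (hX k)
  have hsq : ∀ j : Fin 5, (X j ^ 2 : MvPolynomial (Fin 5) K).IsHomogeneous 2 := fun j => by
    simpa using (hX j).pow 2
  fin_cases i
  · exact isHomogeneous_zero _ _ _
  · exact h2 0 1
  · simpa [homTValues] using (hC _).mul ((hsq 2).sub (h2 0 3))
  · simpa [homTValues] using (hC _).mul ((h2 2 3).sub (h2 0 4))
  · simpa [homTValues] using (hC _).mul ((h2 2 4).sub (hsq 3))

/-- **`T` raises degrees by one**: `T` maps forms of degree `n` to forms of degree `n + 1`.
[cite: NesterenkoPhilippon2001, Ch. 10 §3 (p. 158: `deg_x E_{n+1} ≤ … + 2 d₀ λ a_n`)] -/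
theorem isHomogeneous_homT {G : MvPolynomial (Fin 5) K} {n : ℕ} (hG : G.IsHomogeneous n) :
    (homT K G).IsHomogeneous (n + 1) := by
  classical
  rw [G.as_sum, map_sum]
  refine IsHomogeneous.sum _ _ _ fun d hd => ?_
  rw [homT, MvPolynomial.mkDerivation_monomial, Finsupp.sum]
  rw [Finset.smul_sum]
  refine IsHomogeneous.sum _ _ _ fun i hi => ?_
  have hdeg : d.degree = n := by
    rw [Finsupp.degree_eq_weight_one]; exact hG (mem_support_iff.mp hd)
  have hle : Finsupp.single i 1 ≤ d := by
    rw [Finsupp.single_le_iff]; exact Nat.one_le_iff_ne_zero.mpr (Finsupp.mem_support_iff.mp hi)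
  have hdeg' : (d - Finsupp.single i 1).degree = n - 1 := by
    have h := congrArg Finsupp.degree (tsub_add_cancel_of_le hle)
    rw [map_add, Finsupp.degree_single, hdeg] at h
    omega
  have hn : 1 ≤ n := by
    have h := congrArg Finsupp.degree (tsub_add_cancel_of_le hle)
    rw [map_add, Finsupp.degree_single, hdeg] at h
    omega
  have hmon : (monomial (d - Finsupp.single i 1) ((d i : ℕ) : K)).IsHomogeneous (n - 1) :=
    isHomogeneous_monomial _ hdeg'
  have hterm : (monomial (d - Finsupp.single i 1) ((d i : ℕ) : K) • homTValues K i).IsHomogeneous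
      (n + 1) := by
    rw [smul_eq_mul]
    have := hmon.mul (isHomogeneous_homTValues K i)
    rwa [show n - 1 + 2 = n + 1 by omega] at this
  rw [smul_eq_C_mul]
  simpa using (isHomogeneous_C _ (coeff d G)).mul hterm

end Operator

/-- Iterates of `T` on forms: `T^k G` is a form of degree `n + k`. [folklore] -/
theorem isHomogeneous_homT_iterate (K : Type*) [Field K] {G : MvPolynomial (Fin 5) K} {n : ℕ}
    (hG : G.IsHomogeneous n) (k : ℕ) : ((homT K)^[k] G).IsHomogeneous (n + k) := by
  induction k with
  | zero => simpa using hG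
  | succ k ih =>
    rw [Function.iterate_succ_apply', ← add_assoc]
    exact isHomogeneous_homT K ih

/-- Change of scalars `ℚ → ℂ` commutes with `T`. [folklore] -/
theorem map_homT (G : Rx 4) :
    MvPolynomial.map (algebraMap ℚ ℂ) (homT ℚ G) = homT ℂ (MvPolynomial.map (algebraMap ℚ ℂ) G) := by
  induction G using MvPolynomial.induction_on with
  | C a =>
    rw [map_C, show (C a : Rx 4) = algebraMap ℚ (Rx 4) a from rfl, Derivation.map_algebraMap,
      show (C (algebraMap ℚ ℂ a) : MvPolynomial (Fin 5) ℂ) = algebraMap ℂ _ (algebraMap ℚ ℂ a) from rfl,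
      Derivation.map_algebraMap, map_zero]
  | add p q hp hq => rw [map_add, map_add, map_add, map_add, hp, hq]
  | mul_X p i hp =>
    rw [Derivation.leibniz, map_mul, map_X, Derivation.leibniz, smul_eq_mul, smul_eq_mul, smul_eq_mul,
      smul_eq_mul, map_add, map_mul, map_mul, map_X, hp, homT_X, homT_X]
    congr 2
    fin_cases i <;> simp [homTValues]

/-- **Dehomogenising `T` gives Nesterenko's `D`**: `(T G)(1, ȳ) = D (G(1, ȳ))`.
[cite: NesterenkoPhilippon2001, Ch. 10 §3, (55) and the operator `T` (pp. 154–155)] -/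
theorem dehomog_homT (G : MvPolynomial (Fin 5) ℂ) : dehomog (homT ℂ G) = ramanujanD (dehomog G) := by
  induction G using MvPolynomial.induction_on with
  | C a =>
    have h1 : homT ℂ (C a) = 0 := (homT ℂ).map_algebraMap a
    have h2 : dehomog (C a : MvPolynomial (Fin 5) ℂ) = C a := bind₁_C_right _ _
    have h3 : ramanujanD (C a : MvPolynomial (Fin 4) ℂ) = 0 := ramanujanD.map_algebraMap a
    rw [h1, h2, h3]
    exact map_zero (bind₁ _)
  | add p q hp hq => rw [map_add, dehomog_add, dehomog_add, map_add, hp, hq]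
  | mul_X p i hp =>
    rw [Derivation.leibniz, smul_eq_mul, smul_eq_mul, dehomog_add, dehomog_mul, dehomog_mul, dehomog_mul,
      hp, Derivation.leibniz, smul_eq_mul, smul_eq_mul, homT_X]
    congr 2
    refine Fin.cases ?_ (fun j => ?_) i
    · rw [dehomog_X_zero]
      simp [homTValues, dehomog]
    · rw [dehomog_X_succ, ramanujanD_X]
      have c0 : (Fin.cons (1 : MvPolynomial (Fin 4) ℂ) X : Fin 5 → MvPolynomial (Fin 4) ℂ) 0 = 1 := rfl
      have c1 : (Fin.cons (1 : MvPolynomial (Fin 4) ℂ) X : Fin 5 → MvPolynomial (Fin 4) ℂ) 1 = X 0 := rfl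
      have c2 : (Fin.cons (1 : MvPolynomial (Fin 4) ℂ) X : Fin 5 → MvPolynomial (Fin 4) ℂ) 2 = X 1 := rfl
      have c3 : (Fin.cons (1 : MvPolynomial (Fin 4) ℂ) X : Fin 5 → MvPolynomial (Fin 4) ℂ) 3 = X 2 := rfl
      have c4 : (Fin.cons (1 : MvPolynomial (Fin 4) ℂ) X : Fin 5 → MvPolynomial (Fin 4) ℂ) 4 = X 3 := rfl
      fin_cases j <;> simp [homTValues, dehomog, ramanujanDValues, c0, c1, c2, c3, c4]

/-- **(41) for `T`: `(T G)(ω̂) = θ · G(ω̂)`**, `θ = z d/dz`. [cite: NesterenkoPhilippon2001, Ch. 10 (41) (p. 150)] -/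
theorem alongSeries_homT (G : MvPolynomial (Fin 5) ℂ) :
    alongSeries (homT ℂ G) = ramanujanTheta (alongSeries G) := by
  rw [alongSeries, dehomog_homT, ramanujanComposite_ramanujanD, alongSeries]

/-- Hence **`T` does not lower orders along `ω̂`** (in print (67), `ord C ≥ ord A − 1`, for a
general system; for (45), written with `D = z d/dz`, there is no loss). [cite: NesterenkoPhilippon2001, Ch. 10 (67) (p. 161)] -/
theorem ordAlong_le_ordAlong_homT (G : MvPolynomial (Fin 5) ℂ) : ordAlong G ≤ ordAlong (homT ℂ G) := by
  rw [ordAlong, ordAlong, alongSeries_homT]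
  exact order_le_order_ramanujanTheta _

/-- Iterated: `ord G(ω̂) ≤ ord (T^k G)(ω̂)`. [cite: NesterenkoPhilippon2001, Ch. 10 (67) (p. 161)] -/
theorem ordAlong_le_ordAlong_homT_iterate (G : MvPolynomial (Fin 5) ℂ) (k : ℕ) :
    ordAlong G ≤ ordAlong ((homT ℂ)^[k] G) := by
  induction k with
  | zero => exact le_rfl
  | succ k ih =>
    rw [Function.iterate_succ_apply']
    exact ih.trans (ordAlong_le_ordAlong_homT _)

/-- Change of scalars commutes with the iterates of `T`. [folklore] -/
theorem map_homT_iterate (G : Rx 4) (k : ℕ) :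
    MvPolynomial.map (algebraMap ℚ ℂ) ((homT ℚ)^[k] G) = (homT ℂ)^[k] (MvPolynomial.map (algebraMap ℚ ℂ) G) := by
  induction k with
  | zero => rfl
  | succ k ih => rw [Function.iterate_succ_apply', Function.iterate_succ_apply', map_homT, ih]

/-- Rational coefficients: `ord G(ω̂) ≤ ord (T^k G)(ω̂)`. [cite: NesterenkoPhilippon2001, Ch. 10 (67) (p. 161)] -/
theorem ordAlongQ_le_ordAlongQ_homT_iterate (G : Rx 4) (k : ℕ) :
    ordAlongQ G ≤ ordAlongQ ((homT ℚ)^[k] G) := by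
  rw [ordAlongQ, ordAlongQ, map_homT_iterate]
  exact ordAlong_le_ordAlong_homT_iterate _ k

/-! ### Dehomogenisation of ideals and `D`-stability -/

/-- The ring map `ℚ[x₀, …, x₄] → ℂ[z, x₁, x₂, x₃]`, `G ↦ G(1, z, x₁, x₂, x₃)`. [folklore] -/
def dehomogQ : Rx 4 →+* MvPolynomial (Fin 4) ℂ :=
  ((bind₁ (Fin.cons 1 X : Fin 5 → MvPolynomial (Fin 4) ℂ)).toRingHom).comp
    (MvPolynomial.map (algebraMap ℚ ℂ))

/-- `dehomogQ G = dehomog (G ⊗ ℂ)`. [folklore] -/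
theorem dehomogQ_apply (G : Rx 4) : dehomogQ G = dehomog (MvPolynomial.map (algebraMap ℚ ℂ) G) := rfl

/-- `dehomogQ` intertwines `T` and `D`. [cite: NesterenkoPhilippon2001, Ch. 10 §3 (p. 155)] -/
theorem dehomogQ_homT (G : Rx 4) : dehomogQ (homT ℚ G) = ramanujanD (dehomogQ G) := by
  rw [dehomogQ_apply, dehomogQ_apply, map_homT, dehomog_homT]

/-- **A `T`-stable ideal dehomogenises to a `D`-stable ideal of `ℂ[z, x̄]`** (the ideal `𝔞` of the
proof of Lemma 3.4). [cite: NesterenkoPhilippon2001, Ch. 10 proof of Lemma 3.4 (p. 156)] -/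
theorem isRamanujanDStable_map_dehomogQ {𝔮 : Ideal (Rx 4)} (h𝔮 : ∀ g ∈ 𝔮, homT ℚ g ∈ 𝔮) :
    IsRamanujanDStable (𝔮.map dehomogQ) :=
  DiffIdeal.map_stable (homT ℚ) (ramanujanD.restrictScalars ℚ) dehomogQ (fun x => dehomogQ_homT x) h𝔮

/-- Hence its minimal primes are `D`-stable primes of `ℂ[z, x̄]` (Seidenberg).
[cite: NesterenkoPhilippon2001, Ch. 10 proof of Lemma 3.4 (p. 156)] [cite: Seidenberg1967, Thm. 1] -/
theorem isRamanujanDStable_of_mem_minimalPrimes {𝔮 : Ideal (Rx 4)} (h𝔮 : ∀ g ∈ 𝔮, homT ℚ g ∈ 𝔮)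
    {P : Ideal (MvPolynomial (Fin 4) ℂ)} (hP : P ∈ (𝔮.map dehomogQ).minimalPrimes) :
    IsRamanujanDStable P :=
  DiffIdeal.minimalPrimes_stable (ramanujanD.restrictScalars ℚ) (isRamanujanDStable_map_dehomogQ h𝔮) hP


/-! ### Affine estimates: a Lipschitz bound and an affine representative of a nearby zero -/

/-- **Lipschitz bound for a complex polynomial** on the polydisc of radius `M ≥ 1`:
`|E(y) − E(b)| ≤ L_E(M) · max |yᵢ − bᵢ|`. [folklore] -/
theorem norm_aeval_sub_aeval_le_complex (E : MvPolynomial (Fin 4) ℂ) {M η : ℝ} (hM : 1 ≤ M) (hη : 0 ≤ η)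
    (y b : Fin 4 → ℂ) (hy : ∀ i, ‖y i‖ ≤ M) (hb : ∀ i, ‖b i‖ ≤ M) (hyb : ∀ i, ‖y i - b i‖ ≤ η) :
    ‖aeval y E - aeval b E‖ ≤ (∑ s ∈ E.support, ‖coeff s E‖ * s.degree * M ^ s.degree) * η := by
  have hM0 : 0 ≤ M := zero_le_one.trans hM
  have e : aeval y E - aeval b E = ∑ s ∈ E.support, coeff s E * (∏ i, y i ^ s i - ∏ i, b i ^ s i) := by
    rw [show aeval y E = eval y E from rfl, show aeval b E = eval b E from rfl, eval_eq', eval_eq',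
      ← Finset.sum_sub_distrib]
    refine Finset.sum_congr rfl fun s _ => ?_
    ring
  rw [e, Finset.sum_mul]
  refine (norm_sum_le _ _).trans (Finset.sum_le_sum fun s _ => ?_)
  rw [norm_mul]
  have hdeg : ∑ i, s i = s.degree := (Finsupp.degree_eq_sum s).symm
  have h1 := norm_monomial_sub_le (m := 3) s hdeg y b hM0 hη hy hb hyb
  calc ‖coeff s E‖ * ‖∏ i, y i ^ s i - ∏ i, b i ^ s i‖ ≤ ‖coeff s E‖ * (s.degree * η * M ^ (s.degree - 1)) :=
        mul_le_mul_of_nonneg_left h1 (norm_nonneg _)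
    _ ≤ ‖coeff s E‖ * (s.degree * η * M ^ s.degree) := by
        refine mul_le_mul_of_nonneg_left (mul_le_mul_of_nonneg_left ?_ (by positivity)) (norm_nonneg _)
        exact pow_le_pow_right₀ hM (Nat.sub_le _ _)
    _ = ‖coeff s E‖ * s.degree * M ^ s.degree * η := by ring

/-- **An affine representative of a projectively nearby point.** If `ω₀ = 1`, `|ω̄| ≤ 2`, `β̄ ≠ 0`
and `‖ω̄ − β̄‖ ≤ 1/8` (projective distance), then `β̄` has a representative `b = c β̄` with `b₀ = 1`,
`|ωᵢ − bᵢ| ≤ 8 ‖ω̄ − β̄‖` and `|bᵢ| ≤ 3`. [folklore] -/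
theorem exists_affine_rep {ω β : Fin 5 → ℂ} (hω0 : ω 0 = 1) (hω2 : ‖ω‖ ≤ 2) (hβ : β ≠ 0)
    (hsmall : projDist ω β ≤ 1 / 8) :
    ∃ c : ℂ, c ≠ 0 ∧ (c • β) 0 = 1 ∧ (∀ i, ‖ω i - (c • β) i‖ ≤ 8 * projDist ω β) ∧ ∀ i, ‖(c • β) i‖ ≤ 3 := by
  have hω : ω ≠ 0 := fun h => by simp [h] at hω0
  obtain ⟨c₀, hc₀norm, hc₀near⟩ := exists_rep_near hω hβ
  set γ := c₀ • β with hγ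
  set ε := projDist ω β * ‖ω‖ with hε
  have hpd : 0 ≤ projDist ω β := projDist_nonneg _ _
  have hε2 : ε ≤ 2 * projDist ω β := by
    rw [hε, mul_comm]; exact mul_le_mul_of_nonneg_right hω2 hpd
  have hε14 : ε ≤ 1 / 4 := by linarith
  -- `|1 − γ₀| ≤ ε`, so `|γ₀| ≥ 3/4`
  have hγ0 : ‖1 - γ 0‖ ≤ ε := by simpa [hω0] using hc₀near 0
  have hγ0low : 3 / 4 ≤ ‖γ 0‖ := by
    have := norm_sub_norm_le (1 : ℂ) (1 - γ 0)
    rw [sub_sub_cancel, norm_one] at this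
    linarith
  have hγ0ne : γ 0 ≠ 0 := fun h => by rw [h, norm_zero] at hγ0low; linarith
  have hc₀ne : c₀ ≠ 0 := fun h => by simp [hγ, h] at hγ0ne
  refine ⟨(γ 0)⁻¹ * c₀, mul_ne_zero (inv_ne_zero hγ0ne) hc₀ne, ?_, ?_, ?_⟩
  · simp only [Pi.smul_apply, smul_eq_mul]
    rw [mul_assoc, show c₀ * β 0 = γ 0 from rfl, inv_mul_cancel₀ hγ0ne]
  · intro i
    have hi : ((γ 0)⁻¹ * c₀) • β = fun j => (γ 0)⁻¹ * γ j := by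
      funext j; simp [hγ, mul_assoc]
    rw [hi]
    have e : ω i - (γ 0)⁻¹ * γ i = (γ 0)⁻¹ * ((γ 0 - 1) * ω i + (ω i - γ i)) := by
      field_simp
      ring
    rw [e, norm_mul, norm_inv]
    have hωi : ‖ω i‖ ≤ 2 := (norm_le_pi_norm ω i).trans hω2
    have hnum : ‖(γ 0 - 1) * ω i + (ω i - γ i)‖ ≤ 3 * ε := by
      calc ‖(γ 0 - 1) * ω i + (ω i - γ i)‖ ≤ ‖γ 0 - 1‖ * ‖ω i‖ + ‖ω i - γ i‖ := by
            refine (norm_add_le _ _).trans ?_; rw [norm_mul]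
        _ ≤ ε * 2 + ε := by
            refine add_le_add (mul_le_mul ?_ hωi (norm_nonneg _) ?_) (hc₀near i)
            · rwa [norm_sub_rev]
            · exact le_trans (norm_nonneg _) hγ0
        _ = 3 * ε := by ring
    calc ‖γ 0‖⁻¹ * ‖(γ 0 - 1) * ω i + (ω i - γ i)‖ ≤ (3 / 4)⁻¹ * (3 * ε) := by
          refine mul_le_mul ?_ hnum (norm_nonneg _) (by positivity)
          exact inv_anti₀ (by norm_num) hγ0low
      _ = 4 * ε := by ring
      _ ≤ 8 * projDist ω β := by linarith
  · intro i
    have hωi : ‖ω i‖ ≤ 2 := (norm_le_pi_norm ω i).trans hω2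
    have hi : ((γ 0)⁻¹ * c₀) • β = fun j => (γ 0)⁻¹ * γ j := by
      funext j; simp [hγ, mul_assoc]
    rw [hi, norm_mul, norm_inv]
    have hγi : ‖γ i‖ ≤ 2 := (hc₀norm i).trans hω2
    calc ‖γ 0‖⁻¹ * ‖γ i‖ ≤ (3 / 4)⁻¹ * 2 :=
          mul_le_mul (inv_anti₀ (by norm_num) hγ0low) hγi (norm_nonneg _) (by positivity)
      _ ≤ 3 := by norm_num

/-! ### Zeros: from `V(𝔭)` to the minimal primes of the dehomogenised ideal -/

/-- Evaluation at `(1, ȳ)` factors through `dehomog`. [folklore] -/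
theorem aeval_cons_one (G : MvPolynomial (Fin 5) ℂ) (y : Fin 4 → ℂ) :
    aeval (Fin.cons 1 y : Fin 5 → ℂ) G = aeval y (dehomog G) := by
  have h : (fun i => aeval y ((Fin.cons 1 X : Fin 5 → MvPolynomial (Fin 4) ℂ) i)) = Fin.cons 1 y := by
    funext i
    refine Fin.cases ?_ (fun j => ?_) i <;> simp
  rw [dehomog, aeval_bind₁, h]

/-- Members of a homogeneous ideal vanish at every representative of a projective zero. [folklore] -/
theorem aeval_smul_eq_zero_of_mem_projZeros {𝔭 : Ideal (Rx 4)}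
    (hhom : 𝔭.IsHomogeneous (homogeneousSubmodule (Fin 5) ℚ)) {β : Fin 5 → ℂ} (hβ : β ∈ projZeros 𝔭)
    (c : ℂ) {g : Rx 4} (hg : g ∈ 𝔭) : aeval (c • β) g = 0 := by
  classical
  conv_lhs => rw [← sum_homogeneousComponent g]
  rw [map_sum]
  refine Finset.sum_eq_zero fun n _ => ?_
  have hmem : homogeneousComponent n g ∈ 𝔭 := by
    have := hhom n hg
    rwa [show (DirectSum.decompose (homogeneousSubmodule (Fin 5) ℚ) g n : Rx 4) = homogeneousComponent n g
      from weightedDecomposition.decompose'_apply ℚ (1 : Fin 5 → ℕ) g n] at this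
  rw [aeval_smul_of_isHomogeneous _ (homogeneousComponent_isHomogeneous n g), hβ.2 _ hmem, mul_zero]

/-- **From a zero of `𝔮` with `b₀ = 1` to a minimal prime of its dehomogenisation**: if every
member of `𝔮` vanishes at `(1, ȳ)` then some minimal prime `P` of `𝔮.map dehomogQ` has all its
members vanishing at `ȳ`. [folklore] -/
theorem exists_minimalPrime_vanishing {𝔮 : Ideal (Rx 4)} {y : Fin 4 → ℂ}
    (hy : ∀ g ∈ 𝔮, aeval (Fin.cons 1 y : Fin 5 → ℂ) g = 0) :
    ∃ P ∈ (𝔮.map dehomogQ).minimalPrimes, ∀ E ∈ P, aeval y E = 0 := by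
  set K : Ideal (MvPolynomial (Fin 4) ℂ) := RingHom.ker ((aeval y : MvPolynomial (Fin 4) ℂ →ₐ[ℂ] ℂ) :
    MvPolynomial (Fin 4) ℂ →+* ℂ) with hK
  haveI : K.IsPrime := RingHom.ker_isPrime _
  have hle : 𝔮.map dehomogQ ≤ K := by
    rw [Ideal.map_le_iff_le_comap]
    intro g hg
    rw [Ideal.mem_comap, hK, RingHom.mem_ker, RingHom.coe_coe, dehomogQ_apply, ← aeval_cons_one,
      MvPolynomial.aeval_map_algebraMap]
    exact hy g hg
  obtain ⟨P, hP, hPK⟩ := Ideal.exists_minimalPrimes_le hle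
  exact ⟨P, hP, fun E hE => by simpa [hK] using hPK hE⟩

/-! ### Lemma 3.4 of Ch. 10, projectivised -/

/-- `|I(ω̄(z))| ≲ |z|^N` near `0` as soon as `N ≤ ord I`. [folklore] -/
theorem exists_eventually_iabs_le_pow {I : Ideal (Rx 4)} {r N : ℕ} (h : (N : ℕ∞) ≤ ordI I r) :
    ∃ C : ℝ, 0 < C ∧ ∀ᶠ z in 𝓝 (0 : ℂ), iabs I r (nesterenkoOmega z) ≤ C * ‖z‖ ^ N := by
  rcases eq_or_ne (ordI I r) ⊤ with htop | hne
  · refine ⟨1, one_pos, ?_⟩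
    filter_upwards [Metric.ball_mem_nhds (0 : ℂ) one_pos] with z hz
    rw [Metric.mem_ball, dist_zero_right] at hz
    rw [iabs_eq_zero_of_ordI_eq_top htop hz]
    positivity
  · obtain ⟨V, hV⟩ := ENat.ne_top_iff_exists.mp hne
    have hNV : N ≤ V := by rw [← hV] at h; exact_mod_cast h
    obtain ⟨c, C, -, hC, hev⟩ := exists_bounds_iabs hV.symm
    refine ⟨C, hC, ?_⟩
    filter_upwards [hev, Metric.ball_mem_nhds (0 : ℂ) one_pos] with z hz hz1
    rw [Metric.mem_ball, dist_zero_right] at hz1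
    exact hz.2.trans (mul_le_mul_of_nonneg_left (pow_le_pow_of_le_one (norm_nonneg _) hz1.le hNV) hC.le)

/-- **Deep primes have zeros within `|z|³` of `ω̄(z)`**: if `ord 𝔭 ≥ 3 r deg 𝔭` then, near `z = 0`,
`V(𝔭)` contains `β̄(z)` with `‖ω̄(z) − β̄(z)‖ ≤ K |z|³` (Prop. 4.13).
[cite: NesterenkoPhilippon2001, Ch. 3 Prop. 4.13 (p. 41); Ch. 10 proof of Lemma 3.4 (p. 155)] -/
theorem exists_eventually_projZeros_near {r : ℕ} {𝔭 : Ideal (Rx 4)} (hr1 : 1 ≤ r) (hr4 : r ≤ 4)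
    (hprime : 𝔭.IsPrime) (hhom : 𝔭.IsHomogeneous (homogeneousSubmodule (Fin 5) ℚ))
    (hunm : IsUnmixedOfRank 𝔭 r) (hdeep : ((3 * r * ideg 𝔭 r : ℕ) : ℕ∞) ≤ ordI 𝔭 r) :
    ∃ K : ℝ, 0 < K ∧ ∀ᶠ z in 𝓝 (0 : ℂ), ∃ β ∈ projZeros 𝔭, projDist (nesterenkoOmega z) β ≤ K * ‖z‖ ^ 3 := by
  have hD : 1 ≤ ideg 𝔭 r :=
    one_le_ideg_of_isPrime NesterenkoPhilippon2001_ch3_prop_4_4_holds hr1 hr4 hprime hhom hunm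
  obtain ⟨C, hC, hev⟩ := exists_eventually_iabs_le_pow hdeep
  have hK₀pos : 0 < (C * Real.exp (iheight 𝔭 r)) ^ (1 / (r : ℝ)) * Real.exp (4 * (4 : ℝ) ^ 3 * ideg 𝔭 r) :=
    mul_pos (Real.rpow_pos_of_pos (mul_pos hC (Real.exp_pos _)) _) (Real.exp_pos _)
  obtain ⟨K₀, hK₀, hK₀def⟩ : ∃ K₀ : ℝ, 0 < K₀ ∧
      K₀ = (C * Real.exp (iheight 𝔭 r)) ^ (1 / (r : ℝ)) * Real.exp (4 * (4 : ℝ) ^ 3 * ideg 𝔭 r) :=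
    ⟨_, hK₀pos, rfl⟩
  refine ⟨max K₀ 1, by positivity, ?_⟩
  filter_upwards [hev] with z hz
  obtain ⟨β, hβ, h413⟩ :=
    NesterenkoPhilippon2001_ch3_prop_4_13_holds 4 r 𝔭 hr1 hr4 hhom hunm (nesterenkoOmega z) (nesterenkoOmega_ne_zero z)
  refine ⟨β, hβ, ?_⟩
  have hr0 : (r : ℝ) ≠ 0 := by exact_mod_cast (show r ≠ 0 by omega)
  have hiabs : 0 ≤ iabs 𝔭 r (nesterenkoOmega z) := iabs_nonneg _ _ _
  -- `(|𝔭(ω̄)| e^h)^{1/r} ≤ (C e^h)^{1/r} |z|^{3 deg 𝔭}`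
  have h1 : (iabs 𝔭 r (nesterenkoOmega z) * Real.exp (iheight 𝔭 r)) ^ (1 / (r : ℝ)) ≤
      (C * Real.exp (iheight 𝔭 r)) ^ (1 / (r : ℝ)) * ‖z‖ ^ (3 * ideg 𝔭 r) := by
    have hle : iabs 𝔭 r (nesterenkoOmega z) * Real.exp (iheight 𝔭 r) ≤
        C * Real.exp (iheight 𝔭 r) * (‖z‖ ^ (3 * ideg 𝔭 r)) ^ r := by
      rw [← pow_mul, show 3 * ideg 𝔭 r * r = 3 * r * ideg 𝔭 r by ring]
      calc iabs 𝔭 r (nesterenkoOmega z) * Real.exp (iheight 𝔭 r)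
          ≤ C * ‖z‖ ^ (3 * r * ideg 𝔭 r) * Real.exp (iheight 𝔭 r) :=
            mul_le_mul_of_nonneg_right hz (Real.exp_pos _).le
        _ = C * Real.exp (iheight 𝔭 r) * ‖z‖ ^ (3 * r * ideg 𝔭 r) := by ring
    calc (iabs 𝔭 r (nesterenkoOmega z) * Real.exp (iheight 𝔭 r)) ^ (1 / (r : ℝ))
        ≤ (C * Real.exp (iheight 𝔭 r) * (‖z‖ ^ (3 * ideg 𝔭 r)) ^ r) ^ (1 / (r : ℝ)) :=
          Real.rpow_le_rpow (by positivity) hle (by positivity)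
      _ = (C * Real.exp (iheight 𝔭 r)) ^ (1 / (r : ℝ)) * ((‖z‖ ^ (3 * ideg 𝔭 r)) ^ r) ^ (1 / (r : ℝ)) :=
          Real.mul_rpow (by positivity) (by positivity)
      _ = (C * Real.exp (iheight 𝔭 r)) ^ (1 / (r : ℝ)) * ‖z‖ ^ (3 * ideg 𝔭 r) := by
          rw [one_div, Real.pow_rpow_inv_natCast (by positivity) (by omega)]
  -- hence `‖ω̄ − β̄‖^{deg} ≤ (K |z|³)^{deg}`
  have h2 : projDist (nesterenkoOmega z) β ^ ideg 𝔭 r ≤ (max K₀ 1 * ‖z‖ ^ 3) ^ ideg 𝔭 r := by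
    calc projDist (nesterenkoOmega z) β ^ ideg 𝔭 r
        ≤ (iabs 𝔭 r (nesterenkoOmega z) * Real.exp (iheight 𝔭 r)) ^ (1 / (r : ℝ)) *
            Real.exp (4 * (4 : ℝ) ^ 3 * ideg 𝔭 r) := by exact_mod_cast h413
      _ ≤ (C * Real.exp (iheight 𝔭 r)) ^ (1 / (r : ℝ)) * ‖z‖ ^ (3 * ideg 𝔭 r) *
            Real.exp (4 * (4 : ℝ) ^ 3 * ideg 𝔭 r) := mul_le_mul_of_nonneg_right h1 (Real.exp_pos _).le
      _ = K₀ * (‖z‖ ^ 3) ^ ideg 𝔭 r := by rw [hK₀def, pow_mul]; ring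
      _ ≤ (max K₀ 1) ^ ideg 𝔭 r * (‖z‖ ^ 3) ^ ideg 𝔭 r := by
          refine mul_le_mul_of_nonneg_right ?_ (by positivity)
          calc K₀ ≤ max K₀ 1 := le_max_left _ _
            _ = (max K₀ 1) ^ 1 := (pow_one _).symm
            _ ≤ (max K₀ 1) ^ ideg 𝔭 r := pow_le_pow_right₀ (le_max_right _ _) hD
      _ = (max K₀ 1 * ‖z‖ ^ 3) ^ ideg 𝔭 r := by rw [mul_pow]
  exact le_of_pow_le_pow_left₀ (by omega) (by positivity) h2

/-- **LNM 1752 Ch. 10 Lemma 3.4, with `z` projectivised.** Let `𝔭 ⊂ ℚ[x₀, …, x₄]` be a homogeneous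
prime, `dim 𝔭 = r − 1`, `1 ≤ r ≤ 4`, with `ord 𝔭 ≥ 3 r deg 𝔭` (so that every member of `𝔭`, and
every polynomial vanishing on the zeros of `𝔭` near `ω̄(z)`, vanishes along `ω̂` to order `> 2`, the
constant of the `D`-property of `(P, Q, R)`). Then no non-zero homogeneous prime `𝔮 ⊆ 𝔭` is stable
under `T`. (In print: dehomogenise `𝔮` to the `D`-stable `𝔞`, take `E ∈ 𝔞` of order `≤ c` by the
`D`-property and contradict Cor. 4.9; here `𝔞 ⊗ ℂ` need not be prime, so the `D`-property is applied
to its minimal primes, which are `D`-stable by Seidenberg's lemma and one of which vanishes at the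
affine representative of the zero `β̄(z)` of `𝔭` given by Prop. 4.13.)
[cite: NesterenkoPhilippon2001, Ch. 10 Lemma 3.4 (pp. 155–156)] -/
theorem not_homTStable_of_deep {r : ℕ} {𝔭 𝔮 : Ideal (Rx 4)} (hr1 : 1 ≤ r) (hr4 : r ≤ 4)
    (hprime : 𝔭.IsPrime) (hhom : 𝔭.IsHomogeneous (homogeneousSubmodule (Fin 5) ℚ))
    (hunm : IsUnmixedOfRank 𝔭 r) (hdeep : ((3 * r * ideg 𝔭 r : ℕ) : ℕ∞) ≤ ordI 𝔭 r)
    (h𝔮hom : 𝔮.IsHomogeneous (homogeneousSubmodule (Fin 5) ℚ)) (h𝔮ne : 𝔮 ≠ ⊥) (h𝔮le : 𝔮 ≤ 𝔭)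
    (hT : ∀ g ∈ 𝔮, homT ℚ g ∈ 𝔮) : False := by
  classical
  set 𝔞 : Ideal (MvPolynomial (Fin 4) ℂ) := 𝔮.map dehomogQ with h𝔞
  -- a non-zero homogeneous member of `𝔮`; its dehomogenisation is a non-zero member of `𝔞`
  obtain ⟨g₀, hg₀𝔮, n₀, hg₀hom, hg₀ne⟩ : ∃ g ∈ 𝔮, ∃ n, g.IsHomogeneous n ∧ g ≠ 0 := by
    obtain ⟨g, hg, hgne⟩ := Submodule.exists_mem_ne_zero_of_ne_bot h𝔮ne
    obtain ⟨n, hn⟩ : ∃ n, homogeneousComponent n g ≠ 0 := by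
      by_contra h
      push Not at h
      exact hgne (by rw [← sum_homogeneousComponent g]; exact Finset.sum_eq_zero fun n _ => h n)
    refine ⟨homogeneousComponent n g, ?_, n, homogeneousComponent_isHomogeneous n g, hn⟩
    have := h𝔮hom n hg
    rwa [show (DirectSum.decompose (homogeneousSubmodule (Fin 5) ℚ) g n : Rx 4) = homogeneousComponent n g
      from weightedDecomposition.decompose'_apply ℚ (1 : Fin 5 → ℕ) g n] at this
  have h𝔞ne : ∀ P ∈ 𝔞.minimalPrimes, P ≠ ⊥ := by
    intro P hP hbot
    have hmem : dehomogQ g₀ ∈ P := hP.1.2 (Ideal.mem_map_of_mem _ hg₀𝔮)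
    rw [hbot, Ideal.mem_bot, dehomogQ_apply] at hmem
    refine dehomog_ne_zero_of_isHomogeneous ((hg₀hom.map (algebraMap ℚ ℂ))) ?_ hmem
    exact (MvPolynomial.map_injective _ (algebraMap ℚ ℂ).injective).ne hg₀ne |>.trans_eq (map_zero _) |> id
  -- the finite set of minimal primes of `𝔞`, and for each an element of order `≤ 2` (D-property)
  obtain ⟨S, hS⟩ : ∃ S : Finset (Ideal (MvPolynomial (Fin 4) ℂ)), (S : Set _) = 𝔞.minimalPrimes :=
    ⟨(Ideal.finite_minimalPrimes_of_isNoetherianRing _ 𝔞).toFinset, by simp⟩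
  have hmemS : ∀ P, P ∈ S ↔ P ∈ 𝔞.minimalPrimes := fun P => by rw [← Finset.mem_coe, hS]
  have hE : ∀ P ∈ S, ∃ E ∈ P, (ramanujanComposite E).order ≤ (2 : ℕ∞) := fun P hP =>
    hasRamanujanDProperty_two P ((hmemS P).mp hP).1.1 (h𝔞ne P ((hmemS P).mp hP))
      (isRamanujanDStable_of_mem_minimalPrimes hT ((hmemS P).mp hP))
  choose! E hEP hEord using hE
  -- lower bounds `c |z|² ≤ |E_P(z, P, Q, R)|` near `0`, for all `P ∈ S` at once
  have hlow : ∀ P ∈ S, ∃ c : ℝ, 0 < c ∧ ∀ᶠ z in 𝓝 (0 : ℂ), c * ‖z‖ ^ 2 ≤ ‖aeval (ramanujanPoint z) (E P)‖ := by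
    intro P hP
    obtain ⟨v, hv⟩ : ∃ v : ℕ, (ramanujanComposite (E P)).order = v :=
      (ENat.ne_top_iff_exists.mp ((hEord P hP).trans_lt (by decide)).ne).imp fun _ h => h.symm
    have hv2 : v ≤ 2 := by have := hEord P hP; rw [hv] at this; exact_mod_cast this
    obtain ⟨c, C, hc, -, hev⟩ := exists_bounds_of_hasSum_powerSeries
      (fun w hw => hasSum_ramanujanComposite (E P) hw) hv
    refine ⟨c, hc, ?_⟩
    filter_upwards [hev, Metric.ball_mem_nhds (0 : ℂ) one_pos] with z hz hz1
    rw [Metric.mem_ball, dist_zero_right] at hz1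
    exact (mul_le_mul_of_nonneg_left (pow_le_pow_of_le_one (norm_nonneg _) hz1.le hv2) hc.le).trans hz.1
  choose! c hcpos hc using hlow
  -- Lipschitz constants on the polydisc of radius 3
  set L : Ideal (MvPolynomial (Fin 4) ℂ) → ℝ := fun P =>
    ∑ s ∈ (E P).support, ‖coeff s (E P)‖ * s.degree * (3 : ℝ) ^ s.degree with hL
  have hL0 : ∀ P, 0 ≤ L P := fun P => Finset.sum_nonneg fun s _ => by positivity
  -- zeros of `𝔭` near `ω̄(z)`
  obtain ⟨K, hK, hnear⟩ := exists_eventually_projZeros_near hr1 hr4 hprime hhom hunm hdeep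
  -- uniform constants over `S`
  by_cases hSne : S.Nonempty
  swap
  · -- no minimal primes: `𝔞 = ⊤`; but `𝔞` has zeros near `ω̄(z)` — contradiction at once
    rw [Finset.not_nonempty_iff_eq_empty] at hSne
    have hall := hnear.and eventually_norm_nesterenkoOmega_le_two
    obtain ⟨ε, hε, hball⟩ := Metric.eventually_nhds_iff.mp hall
    -- a small non-zero `z`
    set t : ℝ := min (ε / 2) (min 1 ((1 / 8) / K) ^ (1 : ℕ)) with ht
    have htpos : 0 < t := lt_min (half_pos hε) (by positivity)
    have hz : dist ((t : ℝ) : ℂ) 0 < ε := by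
      rw [dist_zero_right, Complex.norm_real, Real.norm_eq_abs, abs_of_pos htpos]
      exact (min_le_left _ _).trans_lt (half_lt_self hε)
    obtain ⟨⟨β, hβ, hβd⟩, hω1, hω2⟩ := hball hz
    have hβ0 : β ≠ 0 := hβ.1
    -- a representative with `b₀ = 1`
    have hnorm : ‖((t : ℝ) : ℂ)‖ = t := by rw [Complex.norm_real, Real.norm_eq_abs, abs_of_pos htpos]
    have hsmall : projDist (nesterenkoOmega t) β ≤ 1 / 8 := by
      refine hβd.trans ?_
      rw [hnorm]
      have ht1 : t ≤ 1 := (min_le_right _ _).trans (by rw [pow_one]; exact min_le_left _ _)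
      have htK : t ≤ (1 / 8) / K := (min_le_right _ _).trans (by rw [pow_one]; exact min_le_right _ _)
      calc K * t ^ 3 ≤ K * t := by
            refine mul_le_mul_of_nonneg_left ?_ hK.le
            calc t ^ 3 ≤ t ^ 1 := pow_le_pow_of_le_one htpos.le ht1 (by norm_num)
              _ = t := pow_one t
        _ ≤ K * ((1 / 8) / K) := mul_le_mul_of_nonneg_left htK hK.le
        _ = 1 / 8 := by field_simp
    obtain ⟨cβ, -, hb0, -, -⟩ := exists_affine_rep (nesterenkoOmega_zero _) hω2 hβ0 hsmall
    have hzero : ∀ g ∈ 𝔮, aeval (Fin.cons 1 (fun j => (cβ • β) j.succ) : Fin 5 → ℂ) g = 0 := by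
      intro g hg
      have e : (Fin.cons 1 (fun j => (cβ • β) j.succ) : Fin 5 → ℂ) = cβ • β := by
        funext i; refine Fin.cases ?_ (fun j => ?_) i
        · exact hb0.symm
        · rfl
      rw [e]
      exact aeval_smul_eq_zero_of_mem_projZeros hhom hβ cβ (h𝔮le hg)
    obtain ⟨P, hP, -⟩ := exists_minimalPrime_vanishing hzero
    have : P ∈ S := (hmemS P).mpr hP
    rw [hSne] at this
    exact absurd this (Finset.notMem_empty P)
  -- `S` non-empty: uniform `c > 0` and `L`
  obtain ⟨cmin, hcmin, hcle⟩ : ∃ cmin : ℝ, 0 < cmin ∧ ∀ P ∈ S, cmin ≤ c P := by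
    obtain ⟨P₀, hP₀, hmin⟩ := Finset.exists_min_image S c hSne
    exact ⟨c P₀, hcpos P₀ hP₀, hmin⟩
  set Lmax : ℝ := ∑ P ∈ S, L P with hLmax
  have hLle : ∀ P ∈ S, L P ≤ Lmax := fun P hP => Finset.single_le_sum (fun P _ => hL0 P) hP
  have hLmax0 : 0 ≤ Lmax := Finset.sum_nonneg fun P _ => hL0 P
  have hevc : ∀ᶠ z in 𝓝 (0 : ℂ), ∀ P ∈ S, c P * ‖z‖ ^ 2 ≤ ‖aeval (ramanujanPoint z) (E P)‖ :=
    (Filter.eventually_all_finset S).mpr fun P hP => hc P hP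
  have hall := (hnear.and eventually_norm_nesterenkoOmega_le_two).and hevc
  obtain ⟨ε, hε, hball⟩ := Metric.eventually_nhds_iff.mp hall
  -- a small positive real `t`
  set t : ℝ := min (ε / 2) (min 1 (min ((1 / 8) / K) (cmin / (8 * K * Lmax + 1) / 2))) with ht
  have hden : 0 < 8 * K * Lmax + 1 := by positivity
  have htpos : 0 < t := lt_min (half_pos hε) (lt_min one_pos (lt_min (by positivity) (by positivity)))
  have ht1 : t ≤ 1 := (min_le_right _ _).trans (min_le_left _ _)
  have htK : t ≤ (1 / 8) / K := (min_le_right _ _).trans ((min_le_right _ _).trans (min_le_left _ _))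
  have htc : t < cmin / (8 * K * Lmax + 1) := by
    have : t ≤ cmin / (8 * K * Lmax + 1) / 2 :=
      (min_le_right _ _).trans ((min_le_right _ _).trans (min_le_right _ _))
    exact this.trans_lt (half_lt_self (by positivity))
  have hnorm : ‖((t : ℝ) : ℂ)‖ = t := by rw [Complex.norm_real, Real.norm_eq_abs, abs_of_pos htpos]
  have hz : dist ((t : ℝ) : ℂ) 0 < ε := by
    rw [dist_zero_right, hnorm]; exact (min_le_left _ _).trans_lt (half_lt_self hε)
  obtain ⟨⟨⟨β, hβ, hβd⟩, hω1, hω2⟩, hcz⟩ := hball hz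
  rw [hnorm] at hβd hcz
  have hβ0 : β ≠ 0 := hβ.1
  have ht3 : t ^ 3 ≤ t := by
    calc t ^ 3 ≤ t ^ 1 := pow_le_pow_of_le_one htpos.le ht1 (by norm_num)
      _ = t := pow_one t
  have hKt3 : K * t ^ 3 ≤ 1 / 8 := by
    calc K * t ^ 3 ≤ K * t := mul_le_mul_of_nonneg_left ht3 hK.le
      _ ≤ K * ((1 / 8) / K) := mul_le_mul_of_nonneg_left htK hK.le
      _ = 1 / 8 := by field_simp
  have hsmall : projDist (nesterenkoOmega t) β ≤ 1 / 8 := hβd.trans hKt3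
  obtain ⟨cβ, -, hb0, hbnear, hbbound⟩ := exists_affine_rep (nesterenkoOmega_zero _) hω2 hβ0 hsmall
  set b : Fin 5 → ℂ := cβ • β with hb
  set y : Fin 4 → ℂ := fun j => b j.succ with hydef
  -- `b` is a zero of `𝔮` with `b₀ = 1`; pick the minimal prime of `𝔞` vanishing at `y`
  have hzero : ∀ g ∈ 𝔮, aeval (Fin.cons 1 y : Fin 5 → ℂ) g = 0 := by
    intro g hg
    have e : (Fin.cons 1 y : Fin 5 → ℂ) = b := by
      funext i; refine Fin.cases ?_ (fun j => ?_) i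
      · exact hb0.symm
      · rfl
    rw [e]
    exact aeval_smul_eq_zero_of_mem_projZeros hhom hβ cβ (h𝔮le hg)
  obtain ⟨P, hP, hPy⟩ := exists_minimalPrime_vanishing hzero
  have hPS : P ∈ S := (hmemS P).mpr hP
  -- the Lipschitz estimate between `(t, P(t), Q(t), R(t))` and `y`
  have hω_coord : ∀ j : Fin 4, ramanujanPoint (t : ℂ) j = nesterenkoOmega t j.succ := fun j => by
    rw [ramanujanPoint_eq_nesterenkoOmega_succ]
  have hyb : ∀ j : Fin 4, ‖ramanujanPoint (t : ℂ) j - y j‖ ≤ 8 * (K * t ^ 3) := fun j => by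
    rw [hω_coord]
    exact (hbnear j.succ).trans (mul_le_mul_of_nonneg_left hβd (by norm_num))
  have hyM : ∀ j : Fin 4, ‖y j‖ ≤ 3 := fun j => hbbound j.succ
  have hωM : ∀ j : Fin 4, ‖ramanujanPoint (t : ℂ) j‖ ≤ 3 := fun j => by
    rw [hω_coord]
    exact ((norm_le_pi_norm _ _).trans hω2).trans (by norm_num)
  have hlip := norm_aeval_sub_aeval_le_complex (E P) (by norm_num : (1 : ℝ) ≤ 3) (by positivity)
    (ramanujanPoint (t : ℂ)) y hωM hyM hyb
  rw [hPy (E P) (hEP P hPS), sub_zero] at hlip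
  -- combine with the lower bound
  have hlow := hcz P hPS
  have h1 : cmin * t ^ 2 ≤ Lmax * (8 * (K * t ^ 3)) := by
    calc cmin * t ^ 2 ≤ c P * t ^ 2 := mul_le_mul_of_nonneg_right (hcle P hPS) (by positivity)
      _ ≤ ‖aeval (ramanujanPoint (t : ℂ)) (E P)‖ := hlow
      _ ≤ L P * (8 * (K * t ^ 3)) := hlip
      _ ≤ Lmax * (8 * (K * t ^ 3)) := mul_le_mul_of_nonneg_right (hLle P hPS) (by positivity)
  have h2 : cmin ≤ (8 * K * Lmax) * t := by
    have ht2 : 0 < t ^ 2 := by positivity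
    have : cmin * t ^ 2 ≤ (8 * K * Lmax * t) * t ^ 2 := by
      calc cmin * t ^ 2 ≤ Lmax * (8 * (K * t ^ 3)) := h1
        _ = (8 * K * Lmax * t) * t ^ 2 := by ring
    exact le_of_mul_le_mul_right this ht2
  have h3 : (8 * K * Lmax) * t < cmin := by
    calc (8 * K * Lmax) * t ≤ (8 * K * Lmax + 1) * t := mul_le_mul_of_nonneg_right (by linarith) htpos.le
      _ < (8 * K * Lmax + 1) * (cmin / (8 * K * Lmax + 1)) := mul_lt_mul_of_pos_left htc hden
      _ = cmin := by field_simp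
  linarith

end Transfer

end Literature.Barriers.Schanuel

end
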